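import Literature.NumberTheory.GaloisRepresentations.SuperellipticLambdaTorsionCoprime
import Literature.NumberTheory.DiophantineGeometry.PlaneCurvePointCountProofs
import HarnessLib

/-!
# Rational places of `k(C_f)`, `C_f : y^p = f(x)`, over a finite field: `N₁ = #C_f(k) = #{y^p = f(x)} + 1`

Topic `Literature/NumberTheory/GaloisRepresentations` (the superelliptic curves of
`SuperellipticFunctionField` …).  Let `k = 𝔽_q` be a finite field, `p` a prime with `p ≠ 0` in `k`,
`f ∈ k[X]` separable of degree `n` with `p ∤ n`, and `F₀ = k(C_f) = k(x)[y]/(y^p - f(x))`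
(`SuperellipticFunctionField k k p f`, an algebraic function field over `k`).  Then the number of places
of degree one of `F₀/k` — the tree's `numPlacesOfDegree k F₀ 1 = pointCount k F₀ 1` (Stichtenoth
(5.40), `N₁`) — is

  `N₁ = #{(a, b) ∈ k² : b^p = f(a)} + 1`   (`pointCount_one_superelliptic`),

the number of `k`-points of the smooth projective model of `C_f` (its affine points and the one point at
infinity; Stichtenoth Thm. 3.3.7 (Kummer) fibre by fibre over the rational places `P_a`, `P_∞` of
`k(x)`).  Proof, with the tree's counting lemmas for plane models (`PlaneCurvePointCountProofs`):
`N₁ = #{rational poles of x} + ∑_a #{P rational : v_P(x - a) > 0}`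
(`card_ratPlaces_eq_card_poles_add_sum`); the only pole of `x` is the rational place `∞_C`
(`eq_inftyPlace_of_restrict_eq`, `degree_inftyPlace`, as `p ∤ n`); above a root `a` of `f` the only
place is the rational `T_a` (`eq_rootPlace_of_restrict_eq`, `degree_rootPlace`), matching the one
solution `b = 0` of `b^p = f(a) = 0`; and above `a` with `f(a) ≠ 0` the fibre polynomial
`Y^p - f(a)` is separable, so the rational places are counted by its roots `b ∈ k`
(`card_filter_valuation_sub_lt_one_eq`, Kummer's theorem).  Everything is proved; no named facts.
Consumer: the trace of Frobenius on the Tate module of `J(C_f)` over `k̄` (Weil: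
`tr(Frob | V_ℓ) = q + 1 - N₁`), combined with the character-sum evaluation of `#{b³ = f(a)}`
(`picard_card_affinePoints`, `PicardCurveGaloisRep`).

## References
* H. Stichtenoth, *Algebraic Function Fields and Codes*, 2nd ed. (2009), Thm. 3.3.7, eq. (5.40).
  [Stichtenoth2009]
* E. F. Schaefer, Math. Ann. 310 (1998), §3 (the model of `y^p = f(x)`, `p ∤ d`, with one rational point
  at infinity). [Schaefer1998]
-/

noncomputable section

open Polynomial
open scoped Classical Polynomial.Bivariate

namespace Literature.NumberTheory.GaloisRepresentations

open Literature.NumberTheory.DiophantineGeometry Literature.NumberTheory.DiophantineGeometry.AlgFunctionField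

universe u

namespace SuperellipticFunctionField

variable {k : Type u} [Field k] {p : ℕ} {f : k[X]}
variable [Fact (Irreducible (superellipticPoly k k p f))] [hp : Fact p.Prime]

omit [Fact (Irreducible (superellipticPoly k k p f))] hp in
/-- The plane model `Y^p - f(X) ∈ k[X][Y]` of `C_f` over the base field itself. [folklore] -/
theorem superellipticPoly_eq_map_bivariate :
    superellipticPoly k k p f = ((Y ^ p - C f : k[X][Y])).map (algebraMap k[X] (RatFunc k)) := by
  rw [superellipticPoly, Polynomial.map_sub, Polynomial.map_pow, map_X, map_C, Algebra.algebraMap_self,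
    Polynomial.map_id]

omit [Fact (Irreducible (superellipticPoly k k p f))] hp in
/-- `Y^p - f(X)` is monic in `Y` (`p ≠ 0`). [folklore] -/
theorem monic_bivariate (hp0 : p ≠ 0) : (Y ^ p - C f : k[X][Y]).Monic :=
  monic_X_pow_sub_C _ hp0

omit [Fact (Irreducible (superellipticPoly k k p f))] hp in
/-- `deg_Y (Y^p - f(X)) = p`. [folklore] -/
theorem natDegree_bivariate : (Y ^ p - C f : k[X][Y]).natDegree = p :=
  natDegree_X_pow_sub_C

omit [Fact (Irreducible (superellipticPoly k k p f))] hp in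
/-- The fibre polynomial over `x = a`: `(Y^p - f(X))(a, Y) = Y^p - f(a)`. [folklore] -/
theorem bivariate_map_evalRingHom (a : k) :
    (Y ^ p - C f : k[X][Y]).map (evalRingHom a) = X ^ p - C (f.eval a) := by
  rw [Polynomial.map_sub, Polynomial.map_pow, map_X, map_C, coe_evalRingHom]

omit [Fact (Irreducible (superellipticPoly k k p f))] hp in
/-- `(Y^p - f(X))(a, b) = b^p - f(a)`. [folklore] -/
theorem evalEval_bivariate (a b : k) : (Y ^ p - C f : k[X][Y]).evalEval a b = b ^ p - f.eval a := by
  simp [evalEval]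

/-- `y` has minimal polynomial `Y^p - f(x)` over `k(x)`. [folklore] -/
theorem minpoly_genY : minpoly (RatFunc k) (genY k k p f) =
    (Y ^ p - C f : k[X][Y]).map (algebraMap k[X] (RatFunc k)) := by
  rw [← superellipticPoly_eq_map_bivariate, genY]
  exact AdjoinRoot.minpoly_powerBasis_gen_of_monic (monic_superellipticPoly k k p f hp.out.ne_zero)

/-- `k(C_f)/k(x)` is separable when `p ≠ 0` in `k` and `f ≠ 0`. [folklore] -/
theorem isSeparable_of_natCast_ne_zero (hpk : (p : k) ≠ 0) (hf : f ≠ 0) :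
    Algebra.IsSeparable (RatFunc k) (SuperellipticFunctionField k k p f) := by
  refine isSeparable_adjoinRoot_of_separable (monic_superellipticPoly k k p f hp.out.ne_zero) ?_
  rw [superellipticPoly, Algebra.algebraMap_self, Polynomial.map_id]
  refine separable_X_pow_sub_C _ ?_ ?_
  · rw [Ne, ← map_natCast (algebraMap k (RatFunc k)), map_eq_zero]
    exact hpk
  · rw [Ne, map_eq_zero_iff _ (IsFractionRing.injective k[X] (RatFunc k))]
    exact hf

variable [Fintype k]

/-- **Rational places above `x = a`, `f(a) ≠ 0`, versus solutions of `b^p = f(a)`** (Kummer's theorem,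
the tree's `card_filter_valuation_sub_lt_one_eq`, the fibre polynomial `Y^p - f(a)` being separable).
[cite: Stichtenoth2009, Thm. 3.3.7] -/
theorem card_ratPlaces_above_of_eval_ne_zero (hpk : (p : k) ≠ 0) (hf : f ≠ 0) {a : k} (ha : f.eval a ≠ 0) :
    ((finite_setOf_degree_eq (K := k) (F := SuperellipticFunctionField k k p f) 1).toFinset.filter
        fun P ↦ P.valuation (genX k k p f - algebraMap k _ a) < 1).card =
      (Finset.univ.filter fun b : k ↦ b ^ p = f.eval a).card := by
  haveI := isSeparable_of_natCast_ne_zero (k := k) (p := p) (f := f) hpk hf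
  haveI : FiniteDimensional (RatFunc k) (SuperellipticFunctionField k k p f) :=
    (AdjoinRoot.powerBasis (Fact.out : Irreducible (superellipticPoly k k p f)).ne_zero).finite
  have h := card_filter_valuation_sub_lt_one_eq (K := k) (F := SuperellipticFunctionField k k p f)
    (monic_bivariate (k := k) (f := f) hp.out.ne_zero) (minpoly_genY (k := k) (p := p) (f := f))
    (by rw [finrank_eq, natDegree_bivariate]) a
    (by rw [bivariate_map_evalRingHom]; exact separable_X_pow_sub_C _ hpk ha)
  simp only [evalEval_bivariate, sub_eq_zero] at h
  exact h

omit [Fintype k] in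
/-- Above a root `a` of `f`, the places with `v_P(x - a) > 0` reduce to the single rational place `T_a`.
[cite: Stichtenoth2009, Thm. 3.1.11] -/
theorem filter_valuation_lt_one_eq_singleton_of_isRoot [Finite k] (hsep : f.Separable) {a : k}
    (ha : (f.map (algebraMap k k)).IsRoot a) :
    ((finite_setOf_degree_eq (K := k) (F := SuperellipticFunctionField k k p f) 1).toFinset.filter
        fun P ↦ P.valuation (genX k k p f - algebraMap k _ a) < 1) = {rootPlace k k p f a} := by
  ext P
  simp only [Finset.mem_filter, Set.Finite.mem_toFinset, Set.mem_setOf_eq, Finset.mem_singleton]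
  constructor
  · rintro ⟨-, hv⟩
    refine eq_rootPlace_of_restrict_eq hsep ha (restrict_eq_placeXSubC_of_ord_pos ?_)
    rwa [← P.valuation_lt_one_iff_ord_pos (genX_sub_algebraMap_ne_zero k k p f a)]
  · rintro rfl
    refine ⟨degree_rootPlace hsep ha, ?_⟩
    rw [PlaceOver.valuation_lt_one_iff_ord_pos _ (genX_sub_algebraMap_ne_zero k k p f a),
      ord_rootPlace_genX_sub hsep ha]
    exact_mod_cast hp.out.pos

omit [Fintype k] in
/-- The rational poles of `x` reduce to the single rational place `∞_C` (`p ∤ deg f`).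
[cite: Schaefer1998, §3] -/
theorem filter_not_mem_eq_singleton_inftyPlace [Finite k] (hndvd : ¬ p ∣ f.natDegree) :
    ((finite_setOf_degree_eq (K := k) (F := SuperellipticFunctionField k k p f) 1).toFinset.filter
        fun P ↦ genX k k p f ∉ P.toValuationSubring) = {inftyPlace k k p f} := by
  ext P
  simp only [Finset.mem_filter, Set.Finite.mem_toFinset, Set.mem_setOf_eq, Finset.mem_singleton]
  constructor
  · rintro ⟨-, hx⟩
    refine eq_inftyPlace_of_restrict_eq hndvd ?_
    rcases eq_ratFuncInftyPlace_or_exists_eq_ofPrime (P.restrict (K := k) (F := RatFunc k)) with h | ⟨q, hq⟩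
    · exact h
    · refine absurd ?_ hx
      have hX : (RatFunc.X : RatFunc k) ∈ (P.restrict (K := k) (F := RatFunc k)).toValuationSubring := by
        rw [hq, ← RatFunc.algebraMap_X]
        exact PlaceOver.algebraMap_mem_ofPrime q _
      have := (PlaceOver.mem_restrict_iff _ _).1 hX
      rwa [← genX_eq_algebraMap_ratFunc] at this
  · rintro rfl
    refine ⟨degree_inftyPlace hndvd, fun hmem => ?_⟩
    have hx0 : genX k k p f ≠ 0 := fun h => transcendental_genX (K := k) (L := k) (p := p) (f := f)
      (h ▸ isAlgebraic_zero)
    have h0 := ((inftyPlace k k p f).mem_toValuationSubring_iff_ord_nonneg hx0).1 hmem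
    rw [ord_inftyPlace_genX hndvd] at h0
    have := hp.out.pos
    omega

/-- **`N₁(k(C_f)) = #{(a, b) ∈ k² : b^p = f(a)} + 1`**: the number of rational places of the function
field of `C_f : y^p = f(x)` over a finite field `k` (`p ≠ 0` in `k`, `f` separable, `p ∤ deg f`) is the
number of affine `k`-points plus the one rational place at infinity.
[cite: Stichtenoth2009, Thm. 3.3.7, eq. (5.40)] [cite: Schaefer1998, §3] -/
theorem numPlacesOfDegree_one_superelliptic (hpk : (p : k) ≠ 0) (hsep : f.Separable)
    (hndvd : ¬ p ∣ f.natDegree) :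
    numPlacesOfDegree k (SuperellipticFunctionField k k p f) 1 =
      Fintype.card {ab : k × k // ab.2 ^ p = f.eval ab.1} + 1 := by
  have hf : f ≠ 0 := ne_zero_of_not_dvd_natDegree hndvd
  have hfk : f.map (algebraMap k k) = f := by rw [Algebra.algebraMap_self, Polynomial.map_id]
  rw [numPlacesOfDegree_eq_card, card_ratPlaces_eq_card_poles_add_sum (genX k k p f),
    filter_not_mem_eq_singleton_inftyPlace hndvd, Finset.card_singleton, add_comm]
  congr 1
  -- fibre by fibre over `x = a`
  have hfib : ∀ a : k, ((finite_setOf_degree_eq (K := k) (F := SuperellipticFunctionField k k p f) 1).toFinset.filter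
      fun P ↦ P.valuation (genX k k p f - algebraMap k _ a) < 1).card =
        (Finset.univ.filter fun b : k ↦ b ^ p = f.eval a).card := by
    intro a
    by_cases ha : f.eval a = 0
    · have hroot : (f.map (algebraMap k k)).IsRoot a := by rwa [hfk]
      rw [filter_valuation_lt_one_eq_singleton_of_isRoot hsep hroot, Finset.card_singleton, ha]
      have : (Finset.univ.filter fun b : k ↦ b ^ p = 0) = {0} := by
        ext b
        simp [pow_eq_zero_iff hp.out.ne_zero]
      rw [this, Finset.card_singleton]
    · exact card_ratPlaces_above_of_eval_ne_zero hpk hf ha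
  rw [Finset.sum_congr rfl fun a _ => hfib a, Fintype.card_subtype]
  simp only [Finset.card_filter, Fintype.sum_prod_type]

/-- **`pointCount k k(C_f) 1 = #{b^p = f(a)} + 1`** (`pointCount … 1 = numPlacesOfDegree … 1`,
Stichtenoth (5.40) at `r = 1`). [cite: Stichtenoth2009, eq. (5.40)] -/
theorem pointCount_one_superelliptic (hpk : (p : k) ≠ 0) (hsep : f.Separable) (hndvd : ¬ p ∣ f.natDegree) :
    pointCount k (SuperellipticFunctionField k k p f) 1 = Fintype.card {ab : k × k // ab.2 ^ p = f.eval ab.1} + 1 := by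
  rw [pointCount_one, numPlacesOfDegree_one_superelliptic hpk hsep hndvd]

end SuperellipticFunctionField

end Literature.NumberTheory.GaloisRepresentations
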